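import Summits.QuantumFields.YangMills.Theorems.ForcedResponseSkewnessRunningCouplingCeilingFemtoLogOfCentred
import Mathlib.Analysis.SpecialFunctions.Log.NegMulLog
import HarnessLib

/-!
# Route `ForcedResponseSkewness`, crux `RunningCouplingCeiling` (stmt-QuantumFields-24275), line «pointwise-log-ceiling-r» v5:
# the centred femto log ceiling `CentredFemtoLogSigR` only needs the engine's OWN radii (a covering set of cube sizes)

Helper file (`--supports stmt-QuantumFields-24275`, width seat `ym-line-frs-p2` g7, the optional task of the lead
`ym-line-frs-p1` g5's WAKE-frs-p2 of 2026-08-28 ~10:3xZ): the two-point twin of the lead's covering-radii transport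
`CentredOsc.centredOscLaw_of_cover` (p621436) for the deciding crux.  The registered AF stub of skeleton v5 is
`stub_centredFemtoLog : CentredFemtoLogSigR` — the femto log two-point ceiling `‖y‖⁸ |kerCov_η^{[-N,N]⁴}(dens 0, dens y)| ≤ C₂/log²(1/(‖y‖·a β))`
at the centre of EVERY centred femto cube.  A multi-scale expansion works on its own cube sizes (radii `N_k`, e.g. `L^k·M`);
here we prove that the ceiling on a set of radii `S` covering every radius from `D₀` on up to a factor `θ ≥ 1`
(`∀ D ≥ D₀ ∃ N ∈ S, N+1 ≤ D ≤ θ(N+1)`) implies it at ALL radii, given the frozen-boundary law `FBL` (the shared engine stub):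

* `centredFemtoLog_of_cover` — `FBL G r a →` (ceiling for radii in `S`) `→` the body of `CentredFemtoLogSigR` for `(G, r, a)`, with femto scale
  `min (min ℓ₂ ℓ₁) 1`, constant `C₂ + 4C₁²`, collar depth `θ·(2K + 2 + |log s|)` and `n₀ ↦ max n₀ (max D₀ 1)`;
* `femtoLog_of_centred_cover` — hence (the lead's `femtoLog_of_centred`, p622058) the body of v4's `FemtoLogSigR` on all cubes and pairs.

Mechanism: for the target cube `[-N',N']⁴` and a pair `(0, y)` pick the cover radius `N ∈ S` of `N'+1`; ONE law-of-total-covariance step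
through `[-N,N]⁴ ⊆ [-N',N']⁴` (`CentredOsc.abs_kerCov_sub_kerE_kerCov_le`): the outer covariance is the outer average of the inner ones — each
under the inner ceiling — plus the covariance of the inner kernel MEANS of `dens 0`, `dens y`, second order in `FBL`: `≤ 4·(C₁/m⁴)(C₁/(m/2)⁴)`,
`m = N+1 ≥ (N'+1)/θ`; the enlarged collar gives `(2 + |log s|)‖y‖ ≤ m`, so `‖y‖⁸·64C₁²/m⁸ ≤ 4C₁²/log²(1/s)` (`remainder_log_le`), and the
femto scale `≤ 1` keeps `s = ‖y‖·a β ≤ 1/2`.  (For the one-point boundary law the tree transports sparse radii by antitonicity,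
`BoundaryLaw.fbl_of_oscillation_cover`; for covariances the law of total covariance replaces it, exactly as in the lead's cover file.)

Honest label: unconditional analysis inside a CONDITIONAL rung line (leaf R2a `BalabanLadder.NT`); the centred log ceiling itself (asymptotic
freedom at one loop to log² precision, uniformly in the exterior — Bałaban-class, not in print), `FBL6`, the crux 24275, NT and the YM mass gap
are NOT proved by any of this.
-/

set_option autoImplicit false

noncomputable section

open MeasureTheory Filter Topology
open Literature.MathematicalPhysics.QuantumFieldTheory Literature.MathematicalPhysics.QuantumLattice
open Literature.Probability.LatticeModels
open Summit.QuantumFields.YangMills.Cruxes.OSLegsFromFemtoAndGap.DlrCollarTransfer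
open Summit.QuantumFields.YangMills.Cruxes.NT.BoundaryLaw
open Summit.QuantumFields.YangMills.Cruxes.ResponseLocalisation.CentredOsc
  (le_depth_centre le_depth_centred_of_norm_le abs_kerCov_sub_kerE_kerCov_le abs_kerE_sub_le_of_forall continuous_kerCov_dens)

namespace Summit.QuantumFields.YangMills.Cruxes.RunningCouplingCeiling.CentredLog

/-! ## Two real-variable lemmas -/

/-- `s·|log s| → 0` as `s → 0⁺` (from the continuity of `s·log s` at `0`). [folklore] -/
theorem tendsto_mul_abs_log : Tendsto (fun s : ℝ => s * |Real.log s|) (𝓝[>] 0) (𝓝 0) := by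
  have h1 : Tendsto (fun s : ℝ => |s * Real.log s|) (𝓝 0) (𝓝 0) := by
    have h := (Real.continuous_mul_log.tendsto 0).abs
    simpa using h
  refine (tendsto_nhdsWithin_of_tendsto_nhds h1).congr' ?_
  filter_upwards [self_mem_nhdsWithin] with s hs
  rw [abs_mul, abs_of_pos (Set.mem_Ioi.1 hs)]

/-- **The collar pays the boundary remainder.**  With `(2 + |log s|)·n ≤ D`, `n > 0` and `log s ≠ 0`:
`n⁸ · 4 · (C/D⁴) · (C/(D/2)⁴) ≤ 4 C² / log²(1/s)` (since `(2 + L)⁸ ≥ 16 L²`). [folklore] -/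
theorem remainder_log_le {C n D s : ℝ} (hn : 0 < n) (hD : (2 + |Real.log s|) * n ≤ D) (hlog : Real.log s ≠ 0) :
    n ^ 8 * (4 * (C / D ^ 4) * (C / (D / 2) ^ 4)) ≤ 4 * C ^ 2 / Real.log (1 / s) ^ 2 := by
  have hL0 : 0 < |Real.log s| := abs_pos.2 hlog
  have hD0 : 0 < D := lt_of_lt_of_le (by positivity) hD
  have hD0' : D ≠ 0 := hD0.ne'
  have e1 : n ^ 8 * (4 * (C / D ^ 4) * (C / (D / 2) ^ 4)) = 64 * C ^ 2 * (n / D) ^ 8 := by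
    rw [div_pow n D]
    field_simp
    ring
  have e2 : Real.log (1 / s) ^ 2 = |Real.log s| ^ 2 := by rw [one_div, Real.log_inv, neg_sq, sq_abs]
  rw [e1, e2]
  have hq : n / D ≤ 1 / (2 + |Real.log s|) := by
    rw [div_le_div_iff₀ hD0 (by positivity)]; linarith
  have hq0 : 0 ≤ n / D := by positivity
  have h8 : (n / D) ^ 8 ≤ (1 / (2 + |Real.log s|)) ^ 8 := pow_le_pow_left₀ hq0 hq 8
  have hkey : 16 * |Real.log s| ^ 2 ≤ (2 + |Real.log s|) ^ 8 := by
    have h2 : 4 ≤ (2 + |Real.log s|) ^ 2 := by nlinarith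
    have h3 : |Real.log s| ^ 2 ≤ (2 + |Real.log s|) ^ 2 := by nlinarith
    have h4 : 1 ≤ (2 + |Real.log s|) ^ 2 := by nlinarith
    calc 16 * |Real.log s| ^ 2 = 4 * 4 * |Real.log s| ^ 2 * 1 := by ring
      _ ≤ (2 + |Real.log s|) ^ 2 * (2 + |Real.log s|) ^ 2 * (2 + |Real.log s|) ^ 2 * (2 + |Real.log s|) ^ 2 := by
          gcongr
      _ = (2 + |Real.log s|) ^ 8 := by ring
  calc 64 * C ^ 2 * (n / D) ^ 8 ≤ 64 * C ^ 2 * (1 / (2 + |Real.log s|)) ^ 8 := by gcongr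
    _ = 64 * C ^ 2 / (2 + |Real.log s|) ^ 8 := by rw [one_div, inv_pow, div_eq_mul_inv]
    _ ≤ 64 * C ^ 2 / (16 * |Real.log s| ^ 2) := div_le_div_of_nonneg_left (by positivity) (by positivity) hkey
    _ = 4 * C ^ 2 / |Real.log s| ^ 2 := by
        field_simp
        ring

/-! ## The cover transport -/

section Cover

variable (G : Type) [Group G] [TopologicalSpace G] [IsTopologicalGroup G] [CompactSpace G]
  [MeasurableSpace G] [BorelSpace G] (r : LatticeRep G)

/-- **The centred femto log ceiling from the ceiling on a covering set of radii.**  For a unit map `0 < a β` with `FBL G r a` and a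
set `S ⊆ ℕ` covering every radius `D ≥ D₀` up to the factor `θ ≥ 1` (`∃ N ∈ S, N+1 ≤ D ≤ θ(N+1)`): if the centred log ceiling
`‖y‖⁸ |kerCov_η^{[-N,N]⁴}(dens 0, dens y)| ≤ C₂/log²(1/(‖y‖ a β))` holds for the radii IN `S` (`β ≥ β₂`, `(2N+1)·a β ≤ ℓ₂`, every exterior,
`n₀ ≤ ‖y‖`, `(K(‖y‖ a β)+1)·‖y‖ ≤ N+1`), it holds for ALL radii — i.e. the body of `CentredFemtoLogSigR` for `(G, r, a)` — with femto scale
`min (min ℓ₂ ℓ₁) 1`, constant `C₂ + 4C₁²`, collar depth `θ·(2K + 2 + |log s|)` and `max n₀ (max D₀ 1)`.  Proof: module docstring. [folklore] -/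
theorem centredFemtoLog_of_cover (a : ℝ → ℝ) (ha : ∀ β, 0 < a β) (hFBL : FBL G r a)
    (S : Set ℕ) (θ : ℝ) (hθ : 1 ≤ θ) (D₀ : ℕ)
    (hcover : ∀ D : ℕ, D₀ ≤ D → ∃ N ∈ S, N + 1 ≤ D ∧ (D : ℝ) ≤ θ * ((N : ℝ) + 1))
    (hlog : ∃ (ℓ₂ C₂ β₂ : ℝ) (K : ℝ → ℝ) (n₀ : ℕ), 0 < ℓ₂ ∧ (∀ s, 1 ≤ K s) ∧
      Filter.Tendsto (fun s : ℝ => s * K s) (nhdsWithin 0 (Set.Ioi 0)) (nhds 0) ∧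
      ∀ β : ℝ, β₂ ≤ β → ∀ N ∈ S, ((2 * N + 1 : ℕ) : ℝ) * a β ≤ ℓ₂ →
        ∀ (η : LGConfig 4 G) (y : Fin 4 → ℤ), (n₀ : ℝ) ≤ ‖siteToE y‖ →
          (K (‖siteToE y‖ * a β) + 1) * ‖siteToE y‖ ≤ (N : ℝ) + 1 →
            ‖siteToE y‖ ^ 8 * |kerCov G r β (fun _ => -(N : ℤ)) (2 * N + 1) η (dens G r 0) (dens G r y)| ≤
              C₂ / Real.log (1 / (‖siteToE y‖ * a β)) ^ 2) :
    ∃ (ℓ₂ C₂ β₂ : ℝ) (K : ℝ → ℝ) (n₀ : ℕ), 0 < ℓ₂ ∧ (∀ s, 1 ≤ K s) ∧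
      Filter.Tendsto (fun s : ℝ => s * K s) (nhdsWithin 0 (Set.Ioi 0)) (nhds 0) ∧
      ∀ β : ℝ, β₂ ≤ β → ∀ N : ℕ, ((2 * N + 1 : ℕ) : ℝ) * a β ≤ ℓ₂ →
        ∀ (η : LGConfig 4 G) (y : Fin 4 → ℤ), (n₀ : ℝ) ≤ ‖siteToE y‖ →
          (K (‖siteToE y‖ * a β) + 1) * ‖siteToE y‖ ≤ (N : ℝ) + 1 →
            ‖siteToE y‖ ^ 8 * |kerCov G r β (fun _ => -(N : ℤ)) (2 * N + 1) η (dens G r 0) (dens G r y)| ≤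
              C₂ / Real.log (1 / (‖siteToE y‖ * a β)) ^ 2 := by
  obtain ⟨ℓ₂, C₂, β₂, K, n₀, hℓ₂, hK1, hKlim, H⟩ := hlog
  obtain ⟨C₁, β₁, ℓ₁, p, hℓ₁, hC₁, hF⟩ := hFBL
  have hθ0 : 0 < θ := by linarith
  refine ⟨min (min ℓ₂ ℓ₁) 1, C₂ + 4 * C₁ ^ 2, max β₂ β₁, fun s => θ * (2 * K s + 2 + |Real.log s|),
    max n₀ (max D₀ 1), lt_min (lt_min hℓ₂ hℓ₁) one_pos, fun s => ?_, ?_, ?_⟩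
  · have h1 : (4 : ℝ) ≤ 2 * K s + 2 + |Real.log s| := by linarith only [hK1 s, abs_nonneg (Real.log s)]
    nlinarith only [h1, hθ]
  · -- `s · K'(s) → 0`
    have h := (((hKlim.const_mul 2).add ((tendsto_nhdsWithin_of_tendsto_nhds tendsto_id).const_mul 2)).add
      tendsto_mul_abs_log).const_mul θ
    have e : (fun s : ℝ => s * (θ * (2 * K s + 2 + |Real.log s|))) =
        fun s => θ * (2 * (s * K s) + 2 * id s + s * |Real.log s|) := by
      funext s; simp only [id]; ring
    rw [e]
    simpa using h
  intro β hβ N' hside η y hn hKM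
  beta_reduce at hKM
  have hβ₂ : β₂ ≤ β := le_trans (le_max_left _ _) hβ
  have hβ₁ : β₁ ≤ β := le_trans (le_max_right _ _) hβ
  have haβ : 0 < a β := ha β
  -- the separation `n = ‖y‖ ≥ max n₀ (max D₀ 1)`
  have hcast : ((max n₀ (max D₀ 1) : ℕ) : ℝ) = max (n₀ : ℝ) (max (D₀ : ℝ) 1) := by push_cast; rfl
  rw [hcast] at hn
  have hn₀ : (n₀ : ℝ) ≤ ‖siteToE y‖ := le_trans (le_max_left _ _) hn
  have hnD₀ : (D₀ : ℝ) ≤ ‖siteToE y‖ := le_trans ((le_max_left _ _).trans (le_max_right _ _)) hn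
  have hn1 : (1 : ℝ) ≤ ‖siteToE y‖ := le_trans ((le_max_right _ _).trans (le_max_right _ _)) hn
  have hn0 : 0 < ‖siteToE y‖ := lt_of_lt_of_le one_pos hn1
  have hKs : 1 ≤ K (‖siteToE y‖ * a β) := hK1 _
  have hL0 : 0 ≤ |Real.log (‖siteToE y‖ * a β)| := abs_nonneg _
  -- the target radius `M = N'+1 ≥ D₀` and the cover radius `N ∈ S`, `m = N+1 ≥ M/θ`
  have hprod : 0 ≤ θ * (2 * K (‖siteToE y‖ * a β) + 2 + |Real.log (‖siteToE y‖ * a β)|) * ‖siteToE y‖ := by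
    positivity
  have hnM : ‖siteToE y‖ ≤ (N' : ℝ) + 1 := by linarith only [hKM, hprod]
  have hD₀ : D₀ ≤ N' + 1 := by exact_mod_cast hnD₀.trans hnM
  obtain ⟨N, hNS, hNle, hθN⟩ := hcover (N' + 1) hD₀
  push_cast at hθN
  have hNN' : N ≤ N' := by omega
  have hmM : (N : ℝ) + 1 ≤ (N' : ℝ) + 1 := by exact_mod_cast hNle
  have hm0 : (0 : ℝ) < (N : ℝ) + 1 := by positivity
  have hsub : cubeEdges (fun _ => -(N : ℤ)) (2 * N + 1) ⊆ cubeEdges (fun _ => -(N' : ℤ)) (2 * N' + 1) :=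
    cubeEdges_centred_subset hNN'
  have hsideN : ((2 * N + 1 : ℕ) : ℝ) * a β ≤ min (min ℓ₂ ℓ₁) 1 := admissible_of_le haβ hNN' hside
  have hsideℓ₂ : ((2 * N + 1 : ℕ) : ℝ) * a β ≤ ℓ₂ := hsideN.trans ((min_le_left _ _).trans (min_le_left _ _))
  have hsideℓ₁ : ((2 * N + 1 : ℕ) : ℝ) * a β ≤ ℓ₁ := hsideN.trans ((min_le_left _ _).trans (min_le_right _ _))
  -- the master inequality `(2K + 2 + |log s|)·‖y‖ ≤ m` (cancel `θ`), and its consequences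
  have hmaster : (2 * K (‖siteToE y‖ * a β) + 2 + |Real.log (‖siteToE y‖ * a β)|) * ‖siteToE y‖ ≤ (N : ℝ) + 1 := by
    refine le_of_mul_le_mul_left ?_ hθ0
    linarith only [hKM, hθN, hn0.le]
  have hKm : (K (‖siteToE y‖ * a β) + 1) * ‖siteToE y‖ ≤ (N : ℝ) + 1 := by nlinarith only [hmaster, hKs, hL0, hn0]
  have hn4 : 4 * ‖siteToE y‖ ≤ (N : ℝ) + 1 := by nlinarith only [hmaster, hKs, hL0, hn0]
  have hlogm : (2 + |Real.log (‖siteToE y‖ * a β)|) * ‖siteToE y‖ ≤ (N : ℝ) + 1 := by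
    nlinarith only [hmaster, hKs, hn0]
  -- `s ≤ 1/2`, so `log s ≠ 0`
  have hs0 : 0 < ‖siteToE y‖ * a β := mul_pos hn0 haβ
  have hs1 : ‖siteToE y‖ * a β < 1 := by
    have h1 : ((N' : ℝ) + 1) * a β ≤ ((2 * N' + 1 : ℕ) : ℝ) * a β := by
      refine mul_le_mul_of_nonneg_right ?_ haβ.le
      push_cast; linarith only [(Nat.cast_nonneg N' : (0 : ℝ) ≤ N')]
    have h2 : ((2 * N' + 1 : ℕ) : ℝ) * a β ≤ 1 := hside.trans (min_le_right _ _)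
    nlinarith only [hn4, hmM, h1, h2, haβ, hn0]
  have hlog : Real.log (‖siteToE y‖ * a β) ≠ 0 := (Real.log_neg hs0 hs1).ne
  -- the boundary law in the inner cube `[-N,N]⁴`: at the centre `0` and at `y` (depth `≥ m/2`)
  have hc0 : (fun j => (0 : Fin 4 → ℤ) j - (N : ℤ)) = fun _ => -(N : ℤ) := by funext j; simp
  have h0Q : ∀ ξ : LGConfig 4 G, |kerE G r β (fun _ => -(N : ℤ)) (2 * N + 1) ξ (dens G r 0) - p β| ≤
      C₁ / ((N : ℝ) + 1) ^ 4 := by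
    intro ξ
    have hdep : (N : ℝ) + 1 ≤ (depth (fun _ => -(N : ℤ)) (2 * N + 1) 0 : ℝ) := by
      have := le_depth_centre (0 : Fin 4 → ℤ) N
      rwa [hc0] at this
    have h2 : 2 ≤ depth (fun _ => -(N : ℤ)) (2 * N + 1) 0 := by
      have : (2 : ℝ) ≤ (depth (fun _ => -(N : ℤ)) (2 * N + 1) 0 : ℝ) := by linarith only [hdep, hn4, hn1]
      exact_mod_cast this
    exact (hF β hβ₁ _ _ hsideℓ₁ ξ 0 h2).trans
      (div_le_div_of_nonneg_left hC₁ (by positivity) (pow_le_pow_left₀ hm0.le hdep 4))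
  have hyQ : ∀ ξ : LGConfig 4 G, |kerE G r β (fun _ => -(N : ℤ)) (2 * N + 1) ξ (dens G r y) - p β| ≤
      C₁ / (((N : ℝ) + 1) / 2) ^ 4 := by
    intro ξ
    have hdep : ((N : ℝ) + 1) / 2 ≤ (depth (fun _ => -(N : ℤ)) (2 * N + 1) y : ℝ) := by
      have h := le_depth_centred_of_norm_le (0 : Fin 4 → ℤ) y N (le_refl ‖siteToE y‖)
      rw [hc0, zero_add] at h
      linarith only [h, hn4, hn0]
    have h2 : 2 ≤ depth (fun _ => -(N : ℤ)) (2 * N + 1) y := by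
      have : (2 : ℝ) ≤ (depth (fun _ => -(N : ℤ)) (2 * N + 1) y : ℝ) := by linarith only [hdep, hn4, hn1]
      exact_mod_cast this
    exact (hF β hβ₁ _ _ hsideℓ₁ ξ y h2).trans
      (div_le_div_of_nonneg_left hC₁ (by positivity) (pow_le_pow_left₀ (by positivity) hdep 4))
  -- Step A: law of total covariance through the inner cube
  have hA := abs_kerCov_sub_kerE_kerCov_le G r β hsub η 0 y h0Q hyQ
  -- Step B: the inner ceiling (radius `N ∈ S`)
  have hcen : ∀ ξ : LGConfig 4 G, |kerCov G r β (fun _ => -(N : ℤ)) (2 * N + 1) ξ (dens G r 0) (dens G r y) - 0| ≤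
      C₂ / Real.log (1 / (‖siteToE y‖ * a β)) ^ 2 / ‖siteToE y‖ ^ 8 := by
    intro ξ
    rw [sub_zero, le_div_iff₀ (pow_pos hn0 8), mul_comm]
    exact H β hβ₂ N hNS hsideℓ₂ ξ y hn₀ hKm
  have hB : |kerE G r β (fun _ => -(N' : ℤ)) (2 * N' + 1) η
      (fun ξ => kerCov G r β (fun _ => -(N : ℤ)) (2 * N + 1) ξ (dens G r 0) (dens G r y)) - 0|
      ≤ C₂ / Real.log (1 / (‖siteToE y‖ * a β)) ^ 2 / ‖siteToE y‖ ^ 8 :=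
    abs_kerE_sub_le_of_forall G r β _ _ η (continuous_kerCov_dens G r β _ _ 0 y) hcen
  rw [sub_zero] at hB
  -- Step C: assemble; the collar pays the boundary remainder
  have hrem := remainder_log_le (C := C₁) (s := ‖siteToE y‖ * a β) hn0 hlogm hlog
  have htot : |kerCov G r β (fun _ => -(N' : ℤ)) (2 * N' + 1) η (dens G r 0) (dens G r y)| ≤
      C₂ / Real.log (1 / (‖siteToE y‖ * a β)) ^ 2 / ‖siteToE y‖ ^ 8 +
        4 * (C₁ / ((N : ℝ) + 1) ^ 4) * (C₁ / (((N : ℝ) + 1) / 2) ^ 4) := by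
    have h1 := abs_sub_abs_le_abs_sub (kerCov G r β (fun _ => -(N' : ℤ)) (2 * N' + 1) η (dens G r 0) (dens G r y))
      (kerE G r β (fun _ => -(N' : ℤ)) (2 * N' + 1) η
        (fun ξ => kerCov G r β (fun _ => -(N : ℤ)) (2 * N + 1) ξ (dens G r 0) (dens G r y)))
    linarith only [h1, hA, hB]
  have e8 : ‖siteToE y‖ ^ 8 * (C₂ / Real.log (1 / (‖siteToE y‖ * a β)) ^ 2 / ‖siteToE y‖ ^ 8) =
      C₂ / Real.log (1 / (‖siteToE y‖ * a β)) ^ 2 := by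
    field_simp
  calc ‖siteToE y‖ ^ 8 * |kerCov G r β (fun _ => -(N' : ℤ)) (2 * N' + 1) η (dens G r 0) (dens G r y)|
      ≤ ‖siteToE y‖ ^ 8 * (C₂ / Real.log (1 / (‖siteToE y‖ * a β)) ^ 2 / ‖siteToE y‖ ^ 8 +
          4 * (C₁ / ((N : ℝ) + 1) ^ 4) * (C₁ / (((N : ℝ) + 1) / 2) ^ 4)) := mul_le_mul_of_nonneg_left htot (by positivity)
    _ = C₂ / Real.log (1 / (‖siteToE y‖ * a β)) ^ 2 +
          ‖siteToE y‖ ^ 8 * (4 * (C₁ / ((N : ℝ) + 1) ^ 4) * (C₁ / (((N : ℝ) + 1) / 2) ^ 4)) := by rw [mul_add, e8]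
    _ ≤ C₂ / Real.log (1 / (‖siteToE y‖ * a β)) ^ 2 + 4 * C₁ ^ 2 / Real.log (1 / (‖siteToE y‖ * a β)) ^ 2 := by
          linarith only [hrem]
    _ = (C₂ + 4 * C₁ ^ 2) / Real.log (1 / (‖siteToE y‖ * a β)) ^ 2 := by rw [add_div]

/-- **The femto log two-point ceiling on ALL femto cubes from `FBL` and the centred ceiling on a covering set of radii**
(`centredFemtoLog_of_cover`, then the lead's `femtoLog_of_centred`): the conclusion is the body of v4's `FemtoLogSigR` for `(G, r, a)`.
So an engine may deliver the AF target of crux 24275 on its own geometric sequence of cubes. [folklore] -/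
theorem femtoLog_of_centred_cover (a : ℝ → ℝ) (ha : ∀ β, 0 < a β) (hlim : Tendsto a atTop (𝓝 0)) (hFBL : FBL G r a)
    (S : Set ℕ) (θ : ℝ) (hθ : 1 ≤ θ) (D₀ : ℕ)
    (hcover : ∀ D : ℕ, D₀ ≤ D → ∃ N ∈ S, N + 1 ≤ D ∧ (D : ℝ) ≤ θ * ((N : ℝ) + 1))
    (hlog : ∃ (ℓ₂ C₂ β₂ : ℝ) (K : ℝ → ℝ) (n₀ : ℕ), 0 < ℓ₂ ∧ (∀ s, 1 ≤ K s) ∧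
      Filter.Tendsto (fun s : ℝ => s * K s) (nhdsWithin 0 (Set.Ioi 0)) (nhds 0) ∧
      ∀ β : ℝ, β₂ ≤ β → ∀ N ∈ S, ((2 * N + 1 : ℕ) : ℝ) * a β ≤ ℓ₂ →
        ∀ (η : LGConfig 4 G) (y : Fin 4 → ℤ), (n₀ : ℝ) ≤ ‖siteToE y‖ →
          (K (‖siteToE y‖ * a β) + 1) * ‖siteToE y‖ ≤ (N : ℝ) + 1 →
            ‖siteToE y‖ ^ 8 * |kerCov G r β (fun _ => -(N : ℤ)) (2 * N + 1) η (dens G r 0) (dens G r y)| ≤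
              C₂ / Real.log (1 / (‖siteToE y‖ * a β)) ^ 2) :
    ∃ (ℓ₂ C₂ β₂ : ℝ) (K : ℝ → ℝ) (n₀ : ℕ), 0 < ℓ₂ ∧ (∀ s, 1 ≤ K s) ∧
      Filter.Tendsto (fun s : ℝ => s * K s) (nhdsWithin 0 (Set.Ioi 0)) (nhds 0) ∧
      ∀ β : ℝ, β₂ ≤ β → ∀ (c : Fin 4 → ℤ) (b : ℕ), (b : ℝ) * a β ≤ ℓ₂ →
        ∀ (η : LGConfig 4 G) (x y : Fin 4 → ℤ), (n₀ : ℝ) ≤ ‖siteToE (y - x)‖ →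
          K (‖siteToE (y - x)‖ * a β) * ‖siteToE (y - x)‖ ≤ (depth c b x : ℝ) →
          K (‖siteToE (y - x)‖ * a β) * ‖siteToE (y - x)‖ ≤ (depth c b y : ℝ) →
            ‖siteToE (y - x)‖ ^ 8 * |kerCov G r β c b η (dens G r x) (dens G r y)| ≤
              C₂ / Real.log (1 / (‖siteToE (y - x)‖ * a β)) ^ 2 :=
  femtoLog_of_centred G r a ha hlim hFBL (centredFemtoLog_of_cover G r a ha hFBL S θ hθ D₀ hcover hlog)

end Cover

end Summit.QuantumFields.YangMills.Cruxes.RunningCouplingCeiling.CentredLog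

end
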